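import Summits.HodgeConjecture.HodgeConjecture.Theorems.SignSymmetricPowersFourFactsMono
import Summits.HodgeConjecture.HodgeConjecture.Theorems.SmoothHypersurfaceGeometricGenus
import Summits.HodgeConjecture.HodgeConjecture.Theorems.SignSymmetricPowersSignThreefoldPowersHodge
import Literature.AlgebraicGeometry.HodgeTheory.A3PencilCircleTransportNotUnipotent
import HarnessLib

/-!
# Crux K1-B `VeryGeneralSignCommutatorsInHg`: the registered stub hN′ `stub_a3NonCommOdd` (skeleton v25k) is a THEOREM;
# K1-B and the rung leaf `SignThreefoldPowersHodge` modulo the single print input hCDK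

Prover seat `hodge-nonav-20241-p1` (g19), cell `hodge-nonav`; helper `--supports stmt-HodgeConjecture-19716`; sorry-free, no definition,
no new named fact. Route `Summits/HodgeConjecture/HodgeConjecture/Theses/SignSymmetricPowers.lean`, crux K1-B (stmt-HodgeConjecture-19716),
registry v25k = {`stub_cdkCover` (hCDK), `stub_a3NonCommOdd` (hN′)} of `Cruxes/VeryGeneralSignCommutatorsInHg/Lines/andre_zariski.lean`.

The binder hN′ — «at a symmetric `A₃` point of the two-parameter family `f₁ + a′g₂ + b g₀` (odd fibre dimension, `g₀ = c·xᵢ^d`), inside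
every bifurcation datum, THE rational transports along the two small circles do not commute» — is proved by the programme A₃-TRACE
(prover-Bx g16: algebra B1/B3/B3⁺, glue (G), socket S1, shell submersion B4b, normal-form chart B4a; littype g22: plane homotopies B5;
19716-p2 g10: keyed pair data and the junction; this seat: the weighted isotopy port B4c `WeightedPencil*` and the leaf
`A3PencilCircleTransportNotUnipotent.symmetricA3NonCommutation_mono_holds`), WITHOUT Milnor-lattice intersection numbers: commuting
Picard–Lefschetz shapes would make the transport around the `A₃` point unipotent; that transport localises (geometric monodromy of the
pencil, Milnor fibration in the chart) to the weighted rotation `R_{2π}` of the Pham–Brieskorn fibre `u⁴ + Σ vⱼ² = 1`, whose square is a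
non-trivial rotation of the quartic coordinate — not unipotent on `Hₙ` (Pham's eigenvector).

* the registered stub `stub_a3NonCommOdd` IS, character for character, the LANDED Literature theorem
  `Literature.AlgebraicGeometry.HodgeTheory.WeightedPencil.symmetricA3NonCommutation_mono_holds` (p691969) — not restated here (the dedup
  lint forbids restating a landed declaration under a second name; the registry keeper re-keys the skeleton to that name, v26 = {hCDK});
* `veryGeneralSignCommutatorsInHg_of_cdkCover (hCDK)` — **K1-B ⟸ {hCDK}** (`…FourFactsMono.veryGeneralSignCommutatorsInHg_of_genusBound_three_facts_mono`
  fed `SmoothHypersurfaceGeometricGenus.stub_genusBoundThreefold`, `hCDK` and `WeightedPencil.symmetricA3NonCommutation_mono_holds`);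
* `signThreefoldPowersHodge_of_cdkCover (hCDK)` — the rung-F-H1 leaf ⟸ {hCDK}.

CONDITIONAL on hCDK = `cmsp_nonHodgeGenericPoints_countable_algebraic_cover` (Cattani–Deligne–Kaplan 1995, print input, item 23152);
nothing here says HC ∕ HC_CM ∕ HC_AV is proved; rung F-H1 not moved.
-/

noncomputable section

set_option linter.dupNamespace false

namespace Summit.HodgeConjecture.HodgeConjecture.Theorems.SignSymmetricPowersStubA3NonCommOdd

open Literature.AlgebraicGeometry.Motives Literature.AlgebraicGeometry.HodgeTheory

/-- **Crux K1-B modulo the single print input hCDK** (Cattani–Deligne–Kaplan): `VeryGeneralSignCommutatorsInHg` from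
`cmsp_nonHodgeGenericPoints_countable_algebraic_cover`, the genus bound `stub_genusBoundThreefold` (landed) and hN′
(`WeightedPencil.symmetricA3NonCommutation_mono_holds`, landed).
[cite: ArnoldGuseinzadeVarchenko2012, Part I §5.2] -/
theorem veryGeneralSignCommutatorsInHg_of_cdkCover (hCDK : cmsp_nonHodgeGenericPoints_countable_algebraic_cover) :
    Summit.HodgeConjecture.HodgeConjecture.Theses.SignSymmetricPowers.VeryGeneralSignCommutatorsInHg :=
  SignSymmetricPowersFourFactsMono.veryGeneralSignCommutatorsInHg_of_genusBound_three_facts_mono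
    SmoothHypersurfaceGeometricGenus.stub_genusBoundThreefold @hCDK WeightedPencil.symmetricA3NonCommutation_mono_holds

/-- **The rung leaf `SignThreefoldPowersHodge` modulo hCDK.** [cite: ArnoldGuseinzadeVarchenko2012, Part I §5.2] -/
theorem signThreefoldPowersHodge_of_cdkCover (hCDK : cmsp_nonHodgeGenericPoints_countable_algebraic_cover) :
    Summit.HodgeConjecture.HodgeConjecture.Theses.SignSymmetricPowers.SignThreefoldPowersHodge :=
  SignSymmetricPowersSignThreefoldPowersHodge.signThreefoldPowersHodge_of_veryGeneralSignCommutatorsInHg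
    (veryGeneralSignCommutatorsInHg_of_cdkCover @hCDK)

end Summit.HodgeConjecture.HodgeConjecture.Theorems.SignSymmetricPowersStubA3NonCommOdd

end
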